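import Literature.NumberTheory.EllipticCurves.GreenbergSelmer
import Literature.NumberTheory.EllipticCurves.ZpExtension
import Literature.NumberTheory.EllipticCurves.SelmerCorankAssembly
import Literature.NumberTheory.EllipticCurves.GaloisActionProofs
import Literature.NumberTheory.EllipticCurves.IwasawaDualModule
import Literature.NumberTheory.GaloisRepresentations.AbsGaloisGroupCompact
import Literature.NumberTheory.EllipticCurves.ZpExtensionPadicUnitsProofs
import HarnessLib

/-!
# X11b, route R1 — hypothesis (iv) `E(ℚ_p)[p] = 0` CONSUMED on the tower: the LOCAL analogue of
# Lemma 2.1 (glob), `E(K_{∞,w})[p^∞] = 0` above `𝔭`, by pro-`p` descent along a `ℤ_p`-extension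

HONEST FRAMING (cell `b2b-bsdres`, run/shared/lean/b2b/bsd-rank1-residual/, verbatim in every
file): the goal of the cell is to DELETE the COMBINATION-SHAPED residual classes of the
Birch–Swinnerton-Dyer formula for ALL analytic-rank `≤ 1` elliptic curves over `ℚ` — "full BSD
formula for every rank `≤ 1` curve in class `C`" assembled STRICTLY from published theorems — so
that the rank-`≤ 1` remainder becomes exactly the CONSTRUCTION-SHAPED classes, which are TYPED
(missing-input `Prop`s), NOT attempted. This is not "finishing BSD". Sub-cell
`b2b-bsdres-multr1-p1` (X11b, route R1 = Castella 2018 Thm. A re-proved along the author's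
erratum); a RESEARCH ROUTE; no claim beyond the stated class; X11b stays CONSTRUCTION-SHAPED;
nothing here changes a label; no named fact is minted (proved theorems only; no `sorry`).

## Why this file

The erratum's Thm. A′ adds to Thm. A the hypothesis **(iv) `E(ℚ_p)[p] = 0`** ("the new
hypothesis (2) will be forced on us to show that the Selmer groups `Sel_𝔭^Σ(K_∞, A_f)` behave well
under congruences", erratum p. 2), used in Lemma 2.1 through "`H⁰(K_𝔭, A_g[ϖ]) = 0` … the kernel
of the second arrow is given by `H⁰(K_𝔭, M_g)/ϖ^m H⁰(K_𝔭, M_g)` and this vanishes when so does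
`H⁰(K_𝔭, A_g[ϖ])`" (erratum p. 2, last lines of the proof of Lemma 2.1). By Shapiro's lemma
`H⁰(K_𝔭, M_g) = H⁰(K_𝔭, T ⊗ Λ^*)` is assembled from the groups `H⁰(K_{∞,w}, A_g)`, `w ∣ 𝔭`, so the
sentence rests on the implication

  `E(K_𝔭)[p] = 0 ⟹ E(K_{∞,w})[p^∞] = 0` for every place `w` of `K_∞` above `𝔭`,

the LOCAL analogue of Lemma 2.1's global step `H⁰(K_∞, A_g) = 0` (gen 8,
`AnticyclotomicTowerTorsion`: `E(K_∞)[p^∞] = 0` from `Irr ∧ Ram`). It is also the vanishing of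
the local kernel `H¹(K_{∞,w}/K_𝔭, E(K_{∞,w})[p^∞])` at the STRICT place `𝔭` in the control
argument for `Sel_𝔭(K_∞, E[p^∞])` (JSW17 §3.3). Until now (iv) was only LOCATED by the cell
(`LocalTorsionChainLocus`, `LocalTorsionTamagawa`: inside the Tamagawa atom); here it is CONSUMED
by a kernel argument on the tree's Galois modules.

## What is proved (namespace `Summit.BirchSwinnertonDyer.Rank1Residual.X11b.AcSelmer`)

Generic **pro-`p` descent** (`eq_zero_of_fixed_inf_kerSubgroup`): `Γ_K` compact, `M` a discrete
`p`-primary `Γ_K`-module with finite `p^k`-torsion for every `k` and continuous orbit maps,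
`κ : Γ_K ↠ ℤ_p` a `ℤ_p`-extension, `D ≤ Γ_K` CLOSED (e.g. a decomposition group), `N = D ⊓ ker κ`
(the decomposition group of `K_∞` at the place above). IF the `D`-fixed points of `M` have no
`p`-torsion THEN `M^N = 0`. Proof (the standard "a pro-`p` group acting on a nonzero `p`-group has a
nonzero fixed point", made effective): (1) `M^D = 0` (`p`-primary without `p`-torsion);
(2) for `m ∈ M^N` with `p^k m = 0` the finite set `A = M^N ∩ M[p^k]` has an open pointwise
stabiliser `V ⊇ N`; the closed sets `(D ∩ κ⁻¹(p^n ℤ_p)) ∖ V` decrease to `(D ∩ ker κ) ∖ V = ∅`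
(`⋂_n κ⁻¹(p^nℤ_p) = ker κ`, tree `ZpExtension.PadicUnits.eq_zero_of_forall_pow_dvd`), so by compactness
`D ∩ κ⁻¹(p^n ℤ_p)` fixes `A` for some `n` (`exists_layerSubgroup_inf_le_stabilizer`); (3) the image
of `D` in `ℤ_p/p^n = ℤ/p^n` is cyclic, generated by the image of some `d₀ ∈ D`
(`exists_generator_mod_layerSubgroup`), so `D`-fixed = fixed by `d₀` and by `D ∩ κ⁻¹(p^nℤ_p)`;
(4) `d₀^{p^n} ∈ κ⁻¹(p^n ℤ_p)` fixes `m`, `p^k m = 0`, hence `(d₀ − 1)^{k p^n} m = 0` (tree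
`IwasawaDual.pow_mul_prime_pow_apply_eq_zero`); peeling one factor `d₀ − 1` at a time, each
`(d₀ − 1)^e m ∈ A` killed by `d₀ − 1` is `D`-fixed, hence `0` by (1); so `m = 0`.

Curve level: **`fixedPoints_decomp_inf_kerSubgroup_eq_bot`** — for an elliptic curve `E/K` over a
number field, a prime `𝔭` of `K`, ANY `ℤ_p`-extension `κ`: if `E(K̄)[p^∞]^{D_𝔭}` has no `p`-torsion
("`E(K_𝔭)[p] = 0`" for the decomposition group `D_𝔭 = decomp 𝔭` of the tree's chosen prime above
`𝔭`) then `E(K̄)[p^∞]^{D_𝔭 ⊓ ker κ} = 0`, i.e. **`E(K_{∞,w})[p^∞] = 0`** at the place `w` of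
`K_∞ = K̄^{ker κ}` above `𝔭` cut out by the chosen embedding (and at every other place above `𝔭`
by conjugating `𝔭`'s embedding, `…_conj`).

What is NOT here: the identification of the hypothesis "`E(K̄)[p^∞]^{D_𝔭}[p] = 0`" with the
erratum's literal `E(ℚ_p)[p] = 0` at a degree-one `𝔭 ∣ p` of an erratum field (Galois descent for
points over `K_𝔭` + `K_𝔭 ≃ ℚ_p`; a separate bookkeeping file), Shapiro's lemma, and any use of the
conclusion in a control / congruence argument.

References: [Castella2018Erratum] Thm. 1.1 (iv), Remark (2) and Lemma 2.1 (pp. 1–2);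
[JetchevSkinnerWan2017] §3.3 (local conditions at `𝔭`; shape only); [GreenbergLNM1716] §3
Lemma 3.1 (p. 86) (`B = E(F_∞)[p^∞]`); [SerreLocalFields1979] IX.§1 (pro-`p` groups and `p`-groups);
[Washington1997] §13.1 (`ℤ_p`-extensions, layers).
-/

noncomputable section

open scoped Classical

open NumberField IsDedekindDomain Field
open Literature.NumberTheory.EllipticCurves Literature.NumberTheory.EllipticCurves.GreenbergSelmer
open Literature.NumberTheory.GaloisRepresentations

universe u

namespace Summit.BirchSwinnertonDyer.Rank1Residual.X11b.AcSelmer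

variable {K : Type u} [Field K] [NumberField K] {p : ℕ} [Fact p.Prime] (κ : ZpExtension K p)

/-! ## The layers of a `ℤ_p`-extension: `⋂_n κ⁻¹(p^n ℤ_p) = ker κ`, `σ^{p^n} ∈ κ⁻¹(p^n ℤ_p)`,
and a generator of `D` modulo `κ⁻¹(p^n ℤ_p)` -/

omit [NumberField K] in
/-- **`⋂_n κ⁻¹(p^n ℤ_p) = ker κ`**: an element of every layer subgroup lies in `ker κ = Gal(K̄/K_∞)`
(`K_∞ = ⋃ K_n`). [cite: Washington1997, §13.1] -/
theorem mem_kerSubgroup_of_forall_mem_layerSubgroup {σ : absoluteGaloisGroup K}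
    (h : ∀ n : ℕ, σ ∈ κ.layerSubgroup n) : σ ∈ κ.kerSubgroup := by
  rw [ZpExtension.mem_kerSubgroup]
  have h0 : (κ σ).toAdd = 0 :=
    ZpExtension.PadicUnits.eq_zero_of_forall_pow_dvd fun n ↦ ZpExtension.mem_layerSubgroup.mp (h n)
  exact toAdd_eq_zero.mp h0

omit [NumberField K] in
/-- `σ^{p^n} ∈ κ⁻¹(p^n ℤ_p)` for every `σ ∈ Γ_K` (`κ(σ^{p^n}) = p^n κ(σ)`). [cite: Washington1997, §13.1] -/
theorem pow_prime_pow_mem_layerSubgroup (σ : absoluteGaloisGroup K) (n : ℕ) :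
    σ ^ p ^ n ∈ κ.layerSubgroup n := by
  rw [ZpExtension.mem_layerSubgroup, map_pow, toAdd_pow, nsmul_eq_mul, Nat.cast_pow]
  exact dvd_mul_right _ _

omit [NumberField K] in
/-- **A generator of `D` modulo a layer.** For any subgroup `D ≤ Γ_K` and `n`, there is `d₀ ∈ D`
such that every `d ∈ D` is `d₀^i · l` with `i ∈ ℤ` and `l ∈ D ∩ κ⁻¹(p^n ℤ_p)`: the image of `D`
under the reduction `Γ_K → ℤ_p → ℤ/p^n` of `κ` (kernel `κ⁻¹(p^n ℤ_p)`, `PadicInt.ker_toZModPow`) is a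
subgroup of a cyclic group, hence cyclic (`Subgroup.isCyclic`). [cite: Washington1997, §13.1] -/
theorem exists_generator_mod_layerSubgroup (D : Subgroup (absoluteGaloisGroup K)) (n : ℕ) :
    ∃ d₀ ∈ D, ∀ d ∈ D, ∃ (i : ℤ) (l : absoluteGaloisGroup K),
      l ∈ D ⊓ κ.layerSubgroup n ∧ d = d₀ ^ i * l := by
  -- `κ mod p^n` as a homomorphism to the cyclic group `Multiplicative (ℤ/p^n)`
  let f : absoluteGaloisGroup K →* Multiplicative (ZMod (p ^ n)) :=
    (AddMonoidHom.toMultiplicative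
      (PadicInt.toZModPow n : ℤ_[p] →+* ZMod (p ^ n)).toAddMonoidHom).comp
      κ.toContinuousMonoidHom.toMonoidHom
  have hf : ∀ σ : absoluteGaloisGroup K, f σ = 1 ↔ σ ∈ κ.layerSubgroup n := fun σ ↦ by
    rw [ZpExtension.mem_layerSubgroup, ← Ideal.mem_span_singleton, ← PadicInt.ker_toZModPow,
      RingHom.mem_ker]
    simp only [f, MonoidHom.coe_comp, Function.comp_apply,
      AddMonoidHom.toMultiplicative_apply_apply, RingHom.toAddMonoidHom_eq_coe,
      AddMonoidHom.coe_coe, ofAdd_eq_one]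
    rfl
  haveI : IsCyclic (D.map f) := Subgroup.isCyclic _
  obtain ⟨g₀, hg₀⟩ := IsCyclic.exists_generator (α := D.map f)
  obtain ⟨d₀, hd₀D, hd₀⟩ := Subgroup.mem_map.mp g₀.2
  refine ⟨d₀, hd₀D, fun d hd ↦ ?_⟩
  obtain ⟨i, hi⟩ := Subgroup.mem_zpowers_iff.mp (hg₀ ⟨f d, Subgroup.mem_map_of_mem _ hd⟩)
  have hi' : f d = f d₀ ^ i := by
    have := congrArg Subtype.val hi
    simp only [SubgroupClass.coe_zpow] at this
    rw [← this, hd₀]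
  have hl : (d₀ ^ i)⁻¹ * d ∈ κ.layerSubgroup n := by
    rw [← hf, map_mul, map_inv, map_zpow, hi', inv_mul_cancel]
  exact ⟨i, (d₀ ^ i)⁻¹ * d, Subgroup.mem_inf.mpr ⟨D.mul_mem (D.inv_mem (D.zpow_mem hd₀D i)) hd, hl⟩,
    (mul_inv_cancel_left _ _).symm⟩

/-! ## Pro-`p` descent along a `ℤ_p`-extension -/

section Generic

variable {M : Type u} [AddCommGroup M] [DistribMulAction (absoluteGaloisGroup K) M]
  [TopologicalSpace M] [DiscreteTopology M]

omit [NumberField K] [Fact p.Prime] [TopologicalSpace M] [DiscreteTopology M] in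
/-- **(1) A `p`-primary `D`-module whose `D`-fixed points have no `p`-torsion has NO nonzero
`D`-fixed point** (if `p^{k+1} m = 0` then `p^k m` is fixed and `p`-torsion, so `0`; induct).
[folklore] -/
theorem eq_zero_of_fixed_of_noPTorsion (D : Subgroup (absoluteGaloisGroup K))
    (h0 : ∀ m : M, (∀ d ∈ D, d • m = m) → p • m = 0 → m = 0)
    {k : ℕ} : ∀ {m : M}, (∀ d ∈ D, d • m = m) → p ^ k • m = 0 → m = 0 := by
  induction k with
  | zero => intro m _ hm; rwa [pow_zero, one_smul] at hm
  | succ k ih =>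
    intro m hm hpk
    refine ih hm ?_
    refine h0 _ (fun d hd ↦ ?_) ?_
    · rw [smul_comm, hm d hd]
    · rw [← mul_smul, ← pow_succ', hpk]

/-- **(2) Compactness: some layer of `D` fixes a given finite set of `N`-fixed points.** For
`D ≤ Γ_K` closed, `N = D ⊓ ker κ`, and a finite set `A ⊆ M` of `N`-fixed elements (continuous orbit
maps, `M` discrete), there is `n` such that every `d ∈ D ∩ κ⁻¹(p^n ℤ_p)` fixes `A` pointwise: the
closed sets `(D ∩ κ⁻¹(p^nℤ_p)) ∖ V`, `V` the open pointwise stabiliser of `A`, decrease to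
`(D ∩ ker κ) ∖ V = ∅` in the compact group `Γ_K`. [cite: Washington1997, §13.1] -/
theorem exists_layerSubgroup_inf_le_stabilizer (D : Subgroup (absoluteGaloisGroup K))
    (hD : IsClosed (D : Set (absoluteGaloisGroup K)))
    (hcont : ∀ m : M, Continuous fun g : absoluteGaloisGroup K ↦ g • m) {A : Set M}
    (hA : A.Finite) (hAN : ∀ a ∈ A, ∀ g ∈ D ⊓ κ.kerSubgroup, g • a = a) :
    ∃ n : ℕ, ∀ g ∈ D ⊓ κ.layerSubgroup n, ∀ a ∈ A, g • a = a := by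
  -- the open pointwise stabiliser `V` of `A`
  set V : Set (absoluteGaloisGroup K) := ⋂ a ∈ A, {g | g • a = a} with hV
  have hVopen : IsOpen V :=
    hA.isOpen_biInter fun a _ ↦ (isOpen_discrete ({a} : Set M)).preimage (hcont a)
  -- the closed decreasing family `F n = κ⁻¹(p^n ℤ_p) ∖ V`
  set F : ℕ → Set (absoluteGaloisGroup K) := fun n ↦ (κ.layerSubgroup n : Set _) ∩ Vᶜ with hF
  have hFclosed : ∀ n, IsClosed (F n) := fun n ↦
    ((κ.layerSubgroup n).isClosed_of_isOpen (κ.isOpen_layerSubgroup n)).inter hVopen.isClosed_compl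
  have hFdir : Directed (· ⊇ ·) F := fun i j ↦ ⟨max i j,
    Set.inter_subset_inter_left _ (κ.layerSubgroup_antitone (le_max_left i j)),
    Set.inter_subset_inter_left _ (κ.layerSubgroup_antitone (le_max_right i j))⟩
  have hempty : (D : Set (absoluteGaloisGroup K)) ∩ ⋂ n, F n = ∅ := by
    rw [Set.eq_empty_iff_forall_notMem]
    rintro g ⟨hgD, hgF⟩
    rw [Set.mem_iInter] at hgF
    have hgker : g ∈ κ.kerSubgroup :=
      mem_kerSubgroup_of_forall_mem_layerSubgroup κ fun n ↦ (hgF n).1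
    have hgV : g ∈ V := by
      rw [hV, Set.mem_iInter₂]
      exact fun a ha ↦ hAN a ha g (Subgroup.mem_inf.mpr ⟨hgD, hgker⟩)
    exact (hgF 0).2 hgV
  obtain ⟨n, hn⟩ := hD.isCompact.elim_directed_family_closed F hFclosed hempty hFdir
  refine ⟨n, fun g hg a ha ↦ ?_⟩
  obtain ⟨hgD, hgL⟩ := Subgroup.mem_inf.mp hg
  have hgV : g ∈ V := by
    by_contra hgV
    have : g ∈ (D : Set (absoluteGaloisGroup K)) ∩ F n := ⟨hgD, hgL, hgV⟩
    rw [hn] at this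
    exact this
  rw [hV, Set.mem_iInter₂] at hgV
  exact hgV a ha

/-- **Pro-`p` descent along a `ℤ_p`-extension.** `Γ_K` compact; `M` a discrete `Γ_K`-module with
continuous orbit maps, `p`-primary, with finite `p^k`-torsion for each `k`; `D ≤ Γ_K` closed;
`N = D ⊓ ker κ`. If the `D`-fixed points of `M` have no `p`-torsion, then **`M^N = 0`**: every
`m ∈ M` fixed by `N` is `0`. (A pro-`p` group — here `D/N ↪ Gal(K_∞/K) ≃ ℤ_p` — acting on a nonzero
discrete `p`-primary module has a nonzero fixed point; steps (1)–(4) of the module docstring.)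
[cite: SerreLocalFields1979, IX.§1 (Lemma: a `p`-group acting on a `p`-group fixes a nonzero element)] [cite: GreenbergLNM1716, §3 Lemma 3.1 (p. 86)] -/
theorem eq_zero_of_fixed_inf_kerSubgroup (D : Subgroup (absoluteGaloisGroup K))
    (hD : IsClosed (D : Set (absoluteGaloisGroup K)))
    (hcont : ∀ m : M, Continuous fun g : absoluteGaloisGroup K ↦ g • m)
    (htor : ∀ m : M, ∃ k : ℕ, p ^ k • m = 0)
    (hfin : ∀ k : ℕ, Set.Finite {m : M | p ^ k • m = 0})
    (h0 : ∀ m : M, (∀ d ∈ D, d • m = m) → p • m = 0 → m = 0)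
    {m : M} (hm : ∀ g ∈ D ⊓ κ.kerSubgroup, g • m = m) : m = 0 := by
  obtain ⟨k, hk⟩ := htor m
  -- the finite `D`-stable set `A = M^N ∩ M[p^k]`
  set A : Set M := {a | p ^ k • a = 0 ∧ ∀ g ∈ D ⊓ κ.kerSubgroup, g • a = a} with hAdef
  have hAfin : A.Finite := (hfin k).subset fun a ha ↦ ha.1
  have hmA : m ∈ A := ⟨hk, hm⟩
  have hAstab : ∀ d ∈ D, ∀ a ∈ A, d • a ∈ A := by
    intro d hd a ha
    refine ⟨by rw [smul_comm, ha.1, smul_zero], fun g hg ↦ ?_⟩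
    obtain ⟨hgD, hgker⟩ := Subgroup.mem_inf.mp hg
    have hc : d⁻¹ * g * d ∈ D ⊓ κ.kerSubgroup := by
      refine Subgroup.mem_inf.mpr ⟨D.mul_mem (D.mul_mem (D.inv_mem hd) hgD) hd, ?_⟩
      rw [ZpExtension.mem_kerSubgroup] at hgker ⊢
      rw [map_mul, map_mul, map_inv, hgker, mul_one, inv_mul_cancel]
    have key := ha.2 _ hc
    rw [mul_smul, mul_smul] at key
    have key' := congrArg (d • ·) key
    simpa only [smul_inv_smul] using key'
  have hAsub : ∀ a ∈ A, ∀ b ∈ A, a - b ∈ A := fun a ha b hb ↦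
    ⟨by rw [smul_sub, ha.1, hb.1, sub_zero], fun g hg ↦ by rw [smul_sub, ha.2 g hg, hb.2 g hg]⟩
  -- (2) a layer of `D` fixing `A`
  obtain ⟨n, hn⟩ := exists_layerSubgroup_inf_le_stabilizer κ D hD hcont hAfin
    (fun a ha g hg ↦ ha.2 g hg)
  -- (3) a generator `d₀` of `D` modulo that layer: `D`-fixed on `A` = fixed by `d₀`
  obtain ⟨d₀, hd₀D, hgen⟩ := exists_generator_mod_layerSubgroup κ D n
  have hfixD : ∀ a ∈ A, d₀ • a = a → ∀ d ∈ D, d • a = a := by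
    intro a ha hfix d hd
    obtain ⟨i, l, hl, rfl⟩ := hgen d hd
    have hzpow : d₀ ^ i ∈ MulAction.stabilizer (absoluteGaloisGroup K) a :=
      Subgroup.zpow_mem _ (MulAction.mem_stabilizer_iff.mpr hfix) i
    rw [mul_smul, hn l hl a ha, MulAction.mem_stabilizer_iff.mp hzpow]
  -- (4) `(d₀ - 1)` is nilpotent on `m`: `d₀^{p^n}` fixes `m`, `p^k m = 0`
  set T : AddMonoid.End M := DistribMulAction.toAddMonoidEnd (absoluteGaloisGroup K) M d₀ with hT
  have hTapply : ∀ x : M, T x = d₀ • x := fun x ↦ rfl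
  have hTpow : ∀ (j : ℕ) (x : M), (T ^ j) x = d₀ ^ j • x := fun j x ↦ by
    rw [hT, ← map_pow]; rfl
  have hTfix : (T ^ p ^ n) m = m := by
    rw [hTpow]
    exact hn _ (Subgroup.mem_inf.mpr ⟨D.pow_mem hd₀D _, pow_prime_pow_mem_layerSubgroup κ d₀ n⟩)
      m hmA
  have hnil : ((T - 1) ^ (k * p ^ n)) m = 0 :=
    IwasawaDual.pow_mul_prime_pow_apply_eq_zero (Fact.out : p.Prime) T n hTfix hk
  -- `A` is stable under `T - 1`
  have hTsubA : ∀ a ∈ A, (T - 1) a ∈ A := fun a ha ↦ by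
    rw [IwasawaDual.End_sub_apply, AddMonoid.End.one_apply, hTapply]
    exact hAsub _ (hAstab d₀ hd₀D a ha) _ ha
  have hTsubApow : ∀ (e : ℕ), ∀ a ∈ A, ((T - 1) ^ e) a ∈ A := by
    intro e
    induction e with
    | zero => intro a ha; simpa using ha
    | succ e ih =>
      intro a ha; rw [pow_succ, AddMonoid.End.coe_mul, Function.comp_apply]
      exact ih _ (hTsubA a ha)
  -- peel: `((T-1)^e) a = 0` with `a ∈ A` forces `a = 0`
  have hpeel : ∀ (e : ℕ), ∀ a ∈ A, ((T - 1) ^ e) a = 0 → a = 0 := by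
    intro e
    induction e with
    | zero => intro a _ h; simpa using h
    | succ e ih =>
      intro a ha h
      rw [pow_succ, AddMonoid.End.coe_mul, Function.comp_apply] at h
      have h1 : (T - 1) a = 0 := ih _ (hTsubA a ha) h
      rw [IwasawaDual.End_sub_apply, AddMonoid.End.one_apply, hTapply, sub_eq_zero] at h1
      exact eq_zero_of_fixed_of_noPTorsion D h0 (hfixD a ha h1) ha.1
  exact hpeel _ m hmA hnil

end Generic

/-! ## `E(K_{∞,w})[p^∞] = 0` above `𝔭` from `E(K_𝔭)[p] = 0` -/

section Curve

variable (W : WeierstrassCurve K) [W.IsElliptic]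

omit [NumberField K] [Fact p.Prime] in
/-- `E[p^∞]` has finite `p^k`-torsion (it lies in `E[p^k]`, Silverman III.6.4).
[cite: SilvermanAEC2009, Cor. III.6.4] -/
theorem finite_setOf_geomPrimaryTorsion_pow_smul_eq_zero (hp : p ≠ 0) (k : ℕ) :
    Set.Finite {m : W.geomPrimaryTorsion p | p ^ k • m = 0} := by
  haveI : Finite (W.geomTorsion ((p ^ k : ℕ) : ℤ)) :=
    W.finite_torsionPoints_holds (AlgebraicClosure K) (by exact_mod_cast pow_ne_zero k hp)
  let f : {m : W.geomPrimaryTorsion p | p ^ k • m = 0} → W.geomTorsion ((p ^ k : ℕ) : ℤ) :=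
    fun m ↦ ⟨(m.1 : W.geomPoints), AddSubgroup.torsionBy.nsmul_iff.mpr (by
      rw [← AddSubgroupClass.coe_nsmul, m.2, ZeroMemClass.coe_zero])⟩
  have hf : Function.Injective f := fun a b h ↦
    Subtype.ext (Subtype.ext (congrArg (fun x : W.geomTorsion ((p ^ k : ℕ) : ℤ) ↦ (x : W.geomPoints)) h))
  exact Set.finite_coe_iff.mp (Finite.of_injective f hf)

/-- The decomposition group `D_𝔭 ≤ Γ_K` of the chosen prime above `𝔭` is closed (the continuous
image of the compact group `Γ_{K_𝔭}`). [cite: NeukirchANT1999, Ch. II §9 Prop. (9.6)] -/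
theorem isClosed_decomp (v : HeightOneSpectrum (𝓞 K)) :
    IsClosed (decomp v : Set (absoluteGaloisGroup K)) := by
  haveI : CompactSpace (absoluteGaloisGroup (v.adicCompletion K)) :=
    absoluteGaloisGroup_compactSpace (v.adicCompletion K)
  exact (isCompact_range (absGaloisRestrict K (v.adicCompletion K)).continuous).isClosed

/-- **`E(K_{∞,w})[p^∞] = 0` above `𝔭` from "`E(K_𝔭)[p] = 0`"** — hypothesis (iv) of the erratum's
Thm. A′ consumed on the tower. For an elliptic curve `E/K` over a number field, a finite place `𝔭`,
ANY `ℤ_p`-extension `κ` of `K`: if the points of `E(K̄)[p^∞]` fixed by the decomposition group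
`D_𝔭 = decomp 𝔭` (i.e. `E(K_𝔭)[p^∞]` along the chosen embedding) have no `p`-torsion, then
`E(K̄)[p^∞]` has NO nonzero point fixed by `D_𝔭 ⊓ ker κ`, the decomposition group of `K_∞ = K̄^{ker κ}`
at the place `w ∣ 𝔭` of the chosen embedding: `FixedPoints.addSubgroup (D_𝔭 ⊓ ker κ) E[p^∞] = ⊥`.
This is the local step "`H⁰(K_𝔭, A_g[ϖ]) = 0 ⟹` the local term at `𝔭` vanishes" of the erratum's
Lemma 2.1 and the vanishing of `H¹(K_{∞,w}/K_𝔭, E(K_{∞,w})[p^∞])` in JSW's control argument, on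
the tree's objects. [cite: Castella2018Erratum, Thm. 1.1 (iv) and Lemma 2.1 (pp. 1–2)] [cite: JetchevSkinnerWan2017, §3.3 (control; shape only)] -/
theorem fixedPoints_decomp_inf_kerSubgroup_eq_bot (𝔭 : HeightOneSpectrum (𝓞 K))
    (h0 : ∀ m : W.geomPrimaryTorsion p, (∀ d ∈ decomp 𝔭, d • m = m) → p • m = 0 → m = 0) :
    FixedPoints.addSubgroup ↥(decomp 𝔭 ⊓ κ.kerSubgroup) (W.geomPrimaryTorsion p) = ⊥ := by
  rw [eq_bot_iff]
  intro m hm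
  rw [AddSubgroup.mem_bot]
  refine eq_zero_of_fixed_inf_kerSubgroup κ (decomp 𝔭) (isClosed_decomp 𝔭)
    (W.continuous_smul_geomPrimaryTorsion p)
    (fun x ↦ by
      obtain ⟨k, hk⟩ := x.2
      exact ⟨k, Subtype.ext (by rw [AddSubgroupClass.coe_nsmul, hk]; rfl)⟩)
    (finite_setOf_geomPrimaryTorsion_pow_smul_eq_zero W (Fact.out : p.Prime).ne_zero) h0 ?_
  intro g hg
  exact hm ⟨g, hg⟩

/-- The same at the OTHER places of `K_∞` above `𝔭`: for every `σ ∈ Γ_K` (moving the chosen prime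
above `𝔭` to its `σ`-conjugate, decomposition group `σ D_𝔭 σ⁻¹`), no nonzero point of `E(K̄)[p^∞]`
is fixed by `σ D_𝔭 σ⁻¹ ⊓ ker κ` — the hypothesis transported by `m ↦ σ • m`. [cite: Castella2018Erratum, Thm. 1.1 (iv) and Lemma 2.1 (pp. 1–2)] -/
theorem eq_zero_of_fixed_conj_decomp_inf_kerSubgroup (𝔭 : HeightOneSpectrum (𝓞 K))
    (h0 : ∀ m : W.geomPrimaryTorsion p, (∀ d ∈ decomp 𝔭, d • m = m) → p • m = 0 → m = 0)
    (σ : absoluteGaloisGroup K) {m : W.geomPrimaryTorsion p}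
    (hm : ∀ d ∈ decomp 𝔭, σ * d * σ⁻¹ ∈ κ.kerSubgroup → (σ * d * σ⁻¹) • m = m) : m = 0 := by
  -- `σ⁻¹ • m` is fixed by `D_𝔭 ⊓ ker κ`
  have h : σ⁻¹ • m ∈ FixedPoints.addSubgroup ↥(decomp 𝔭 ⊓ κ.kerSubgroup) (W.geomPrimaryTorsion p) := by
    rintro ⟨d, hd⟩
    obtain ⟨hdD, hdker⟩ := Subgroup.mem_inf.mp hd
    have hconj : σ * d * σ⁻¹ ∈ κ.kerSubgroup := by
      rw [ZpExtension.mem_kerSubgroup] at hdker ⊢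
      rw [map_mul, map_mul, map_inv, hdker, mul_one, mul_inv_cancel]
    have key := hm d hdD hconj
    rw [Subgroup.mk_smul]
    change d • σ⁻¹ • m = σ⁻¹ • m
    rw [mul_smul, mul_smul] at key
    have key' := congrArg (σ⁻¹ • ·) key
    simpa only [inv_smul_smul] using key'
  rw [fixedPoints_decomp_inf_kerSubgroup_eq_bot κ W 𝔭 h0, AddSubgroup.mem_bot, smul_eq_zero_iff_eq]
    at h
  exact h

end Curve

end Summit.BirchSwinnertonDyer.Rank1Residual.X11b.AcSelmer

end
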